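/-
# [B4] (2.14), (1.3)–(1.4) — tools for the HÖLDER letters on the lineage's carriers: row-block operators, isometric
transports, covariant telescoping along nearest-neighbour chains, lattice sup distances

statement-level skeleton of published theorems with citation tags; proofs where landed; nothing here is a claim about
the Yang–Mills mass gap

[B4] = Balaban, *Regularity and decay of lattice Green's functions*, Commun. Math. Phys. 89 (1983) 571–597.

Tools used by `B4HolderLetterBox` (the per-cube Hölder input of (2.18) p.578) and `B4Thm19BoxHolderWalk`:
`rowBlock_opNorm_le` (an operator supported on one block row has `ℓ^∞` norm `≤ √N` × the size of that row),
`siteNorm_transport_mulVec` (transports `U(A(Γ))` are isometries, (1.4); `B4Lemma22ReduceDeriv.siteNorm_flow`),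
`fieldLink_mul_rev` (`U(A_b)U(A_b̄) = 1` for antisymmetric `A`), `transport_append`, `isNNChain_append`,
`chain_covariation_le` (COVARIANT TELESCOPING: `|U(A(Γ))ψ(end) − ψ(start)| ≤ |Γ|·max_b|U(A_b)ψ(b₊) − ψ(b₋)|`),
`supN_mulH_le`, `sum_abs_sub_le_supNorm`, `one_le_supNorm_of_ne`, `holderWt_mul_le` (`(n/r)^α·(r/n) ≤ K` for
`1 ≤ r ≤ nK`, `0 ≤ α ≤ 1`).  No `def`, no `Prop` fact, no `sorry`; axioms standard.
-/
import Literature.MathematicalPhysics.QuantumFieldTheory.Balaban1983to89.B4HolderProbeLeibniz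
import Literature.MathematicalPhysics.QuantumFieldTheory.Balaban1983to89.B4HCubeMixedDiff
import Literature.MathematicalPhysics.QuantumFieldTheory.Balaban1983to89.B4Lemma22HolderBox
import Literature.MathematicalPhysics.QuantumFieldTheory.Balaban1983to89.B4Thm110BoxDerivWalk

namespace Literature.MathematicalPhysics.QuantumFieldTheory.Balaban1983to89.B4HolderChainTools

open Literature.MathematicalPhysics.QuantumFieldTheory.Balaban1983to89.B4Reflection242 (boxDom nbrs mem_nbrs)
open Literature.MathematicalPhysics.QuantumFieldTheory.Balaban1983to89.B4GaugeCovariance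
open Literature.MathematicalPhysics.QuantumFieldTheory.Balaban1983to89.B4Commutators25to211 (mulH fld_mulH_mulVec)
open Literature.MathematicalPhysics.QuantumFieldTheory.Balaban1983to89.B4Lower18Regular (e1 lsum transport_fieldLink
  pathEnd_append)
open Literature.MathematicalPhysics.QuantumFieldTheory.Balaban1983to89.B4Lemma21Region (siteNorm covDeriv
  fld_covDeriv_mulVec_of_mem)
open Literature.MathematicalPhysics.QuantumFieldTheory.Balaban1983to89.B4Lemma22ReduceZero (Box derivA
  siteNorm_gauge_mulVec)
open Literature.MathematicalPhysics.QuantumFieldTheory.Balaban1983to89.B4Lemma22Reduce231 (supN supN_nonneg le_supN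
  supN_le siteNorm_nonneg siteNorm_zero siteNorm_smul siteNorm_add_le)
open Literature.MathematicalPhysics.QuantumFieldTheory.Balaban1983to89.B4PartitionUnity22 (hCube hCube_nonneg
  hCube_le_one hprof D1 D2 D1_nonneg D2_nonneg contDiff_hprof hasCompactSupport_hprof)
open Literature.MathematicalPhysics.QuantumFieldTheory.Balaban1983to89.B4ContourShift (supNorm abs_le_supNorm
  supNorm_nonneg)
open Literature.MathematicalPhysics.QuantumFieldTheory.Balaban1983to89.B4Green242Bridge (boxNbrs)
open Literature.MathematicalPhysics.QuantumFieldTheory.Balaban1983to89.B4Eq220CommutatorZeroBox (HSize mem_boxNbrs_iff)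
open Literature.MathematicalPhysics.QuantumFieldTheory.Balaban1983to89.B4Eq220PartitionSizes (hZ hBox hsize_hBox
  abs_hCube_sub_le)
open Literature.MathematicalPhysics.QuantumFieldTheory.Balaban1983to89.B4Lemma22HolderBox (IsNNChain)
open Literature.MathematicalPhysics.QuantumFieldTheory.Balaban1983to89.B4Lemma22ReduceDeriv (siteNorm_flow)
open Literature.MathematicalPhysics.QuantumFieldTheory.Balaban1983to89.B4Ineq110WalkRoute (norm_mulH_le)
open Literature.MathematicalPhysics.QuantumFieldTheory.Balaban1983to89.B4Ineq110WalkRouteDeriv (unitOp_apply)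
open Literature.MathematicalPhysics.QuantumFieldTheory.Balaban1983to89.B4Ineq19WalkRoute (fld_unitOp_mulVec
  fld_holderOp_mulVec)
open Literature.MathematicalPhysics.QuantumFieldTheory.Balaban1983to89.B4CubeOpReindex (linfty_opNorm_le_of_supN)
open Literature.MathematicalPhysics.QuantumFieldTheory.Balaban1983to89.B4HCubeMixedDiff (mixedDiff_hZ_le)
open Literature.MathematicalPhysics.QuantumFieldTheory.Balaban1983to89.B4HolderProbeLeibniz (norm_holderOp_letter_pair)
open scoped Matrix
open scoped Matrix.Norms.Operator

noncomputable section

variable {d : ℕ}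
variable {ι : Type} [Fintype ι] [DecidableEq ι]

/-! ## 1. Generic tools: row-block operators, orthogonal transports, chains -/

section Tools

variable {X : Type} [Fintype X] [DecidableEq X]

/-- an operator all of whose block rows except the `x`-th vanish has `ℓ^∞`-operator norm `≤ √N·C` as soon as its
`x`-th row obeys `|(TΦ)(x)| ≤ C‖Φ‖_∞`. [cite: Balaban1983RegularityDecay, (2.14) p.577, dictionary] -/
theorem rowBlock_opNorm_le (T : Matrix (X × ι) (X × ι) ℝ) (x : X) {C : ℝ} (hC : 0 ≤ C)
    (hx : ∀ Φ : X × ι → ℝ, siteNorm (fld (T *ᵥ Φ) x) ≤ C * supN Φ)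
    (hz : ∀ (Φ : X × ι → ℝ) (z : X), z ≠ x → fld (T *ᵥ Φ) z = 0) :
    ‖T‖ ≤ Real.sqrt (Fintype.card ι) * C := by
  refine linfty_opNorm_le_of_supN T hC fun Φ => supN_le (mul_nonneg hC (supN_nonneg Φ)) fun z => ?_
  by_cases h : z = x
  · subst h; exact hx Φ
  · rw [hz Φ z h, siteNorm_zero]; exact mul_nonneg hC (supN_nonneg Φ)

omit [Fintype ι] [DecidableEq ι] [Fintype X] in
/-- the rows of a block matrix unit `E_{xy}[B]` outside `x` vanish. [cite: Balaban1983RegularityDecay, (1.3) p.572, dictionary] -/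
theorem fld_unitOp_mulVec_ne [Fintype X] [Fintype ι] (x y : X) (B : Matrix ι ι ℝ) (Φ : X × ι → ℝ) {z : X}
    (hz : z ≠ x) : fld (unitOp x y B *ᵥ Φ) z = 0 := by
  funext k
  simp only [fld_apply, Matrix.mulVec, dotProduct, unitOp_apply, hz, false_and, if_false, zero_mul,
    Finset.sum_const_zero, Pi.zero_apply]

omit [DecidableEq ι] [DecidableEq X] in
/-- `fld` is linear: differences. [folklore] -/
private theorem fld_sub_mulVec (A B : Matrix (X × ι) (X × ι) ℝ) (Φ : X × ι → ℝ) (z : X) :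
    fld ((A - B) *ᵥ Φ) z = fld (A *ᵥ Φ) z - fld (B *ᵥ Φ) z := by
  rw [Matrix.sub_mulVec]; rfl

omit [DecidableEq ι] [DecidableEq X] in
/-- `fld` is linear: scalars. [folklore] -/
private theorem fld_smul_mulVec (σ : ℝ) (A : Matrix (X × ι) (X × ι) ℝ) (Φ : X × ι → ℝ) (z : X) :
    fld ((σ • A) *ᵥ Φ) z = σ • fld (A *ᵥ Φ) z := by
  rw [Matrix.smul_mulVec]; rfl

omit [Fintype X] [DecidableEq X] in
/-- the transport `U(B(Γ))` along any path is an isometry. [cite: Balaban1983RegularityDecay, (1.4) p.572] -/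
theorem siteNorm_transport_mulVec (F : OrthFlow ι) (κ : ℝ) (B : X → X → ℝ) (x : X) (l : List X) (v : ι → ℝ) :
    siteNorm (transport (fieldLink F κ B) x l *ᵥ v) = siteNorm v := by
  rw [transport_fieldLink, siteNorm_flow]

omit [Fintype X] [DecidableEq X] in
/-- for an antisymmetric configuration the link variables of a bond and of its reverse are inverse to each other.
[cite: Balaban1983RegularityDecay, p.576 «A_b̄ = −A_b», (1.2) p.572] -/
theorem fieldLink_mul_rev (F : OrthFlow ι) (κ : ℝ) {B : X → X → ℝ} (hB : ∀ u v, B v u = -B u v) (u v : X) :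
    fieldLink F κ B u v * fieldLink F κ B v u = 1 := by
  show F.U (κ * B u v) * F.U (κ * B v u) = 1
  rw [← F.map_add, hB u v, mul_neg, add_neg_cancel, F.map_zero]

omit [Fintype ι] [DecidableEq ι] [Fintype X] [DecidableEq X] in
/-- transport along a concatenated path. [cite: Balaban1983RegularityDecay, (1.4) p.572] -/
theorem transport_append [Fintype ι] [DecidableEq ι] (W : X → X → Matrix ι ι ℝ) :
    ∀ (x : X) (l₁ l₂ : List X), transport W x (l₁ ++ l₂) = transport W x l₁ * transport W (pathEnd x l₁) l₂
  | x, [], l₂ => by simp [transport, pathEnd]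
  | x, y :: l₁, l₂ => by
      rw [List.cons_append, transport, transport, transport_append W y l₁ l₂, Matrix.mul_assoc]
      rfl

/-- nearest-neighbour chains concatenate (contours `Γ_{x,x′}` composed of bonds, (1.4)). [cite: Balaban1983RegularityDecay, (1.4) p.572, dictionary] -/
theorem isNNChain_append {R : Finset (Fin (d + 1) → ℤ)} :
    ∀ (x : ↥R) (l₁ l₂ : List ↥R), IsNNChain x l₁ → IsNNChain (pathEnd x l₁) l₂ → IsNNChain x (l₁ ++ l₂)
  | _, [], _, _, h₂ => h₂
  | x, y :: l₁, l₂, h₁, h₂ => by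
      have h₁' : y.1 ∈ nbrs x.1 ∧ IsNNChain y l₁ := h₁
      exact ⟨h₁'.1, isNNChain_append y l₁ l₂ h₁'.2 h₂⟩

/-- **COVARIANT TELESCOPING ALONG A CHAIN**: for an antisymmetric configuration `B` and a field `Ψ` all of whose
forward covariant bond differences `|U(B_{⟨u,u+e_ν⟩})ψ(u+e_ν) − ψ(u)|` are `≤ β`, the transported difference over a
nearest-neighbour chain obeys `|U(B(Γ))ψ(end) − ψ(start)| ≤ |Γ|·β` (the links are isometries).
[cite: Balaban1983RegularityDecay, (2.14) p.577, (1.3)–(1.4) p.572] -/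
theorem chain_covariation_le (F : OrthFlow ι) (κ : ℝ) {R : Finset (Fin (d + 1) → ℤ)} {B : ↥R → ↥R → ℝ}
    (hB : ∀ u v, B v u = -B u v) (Ψ : ↥R × ι → ℝ) {β : ℝ}
    (hβ : ∀ (ν : Fin (d + 1)) (u ue : ↥R), ue.1 = u.1 + e1 ν →
      siteNorm (fieldLink F κ B u ue *ᵥ fld Ψ ue - fld Ψ u) ≤ β) :
    ∀ (x : ↥R) (l : List ↥R), IsNNChain x l →
      siteNorm (transport (fieldLink F κ B) x l *ᵥ fld Ψ (pathEnd x l) - fld Ψ x) ≤ l.length * β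
  | x, [], _ => by simp [transport, pathEnd, siteNorm_zero]
  | x, y :: l, hl => by
      have hl' : y.1 ∈ nbrs x.1 ∧ IsNNChain y l := hl
      have ih := chain_covariation_le F κ hB Ψ hβ y l hl'.2
      have hstep : siteNorm (fieldLink F κ B x y *ᵥ fld Ψ y - fld Ψ x) ≤ β := by
        obtain ⟨ν, hν | hν⟩ := mem_nbrs.1 hl'.1
        · exact hβ ν x y hν
        · have hx : x.1 = y.1 + e1 ν := by rw [hν, e1]; abel
          have h1 := hβ ν y x hx
          have hrev : fieldLink F κ B x y *ᵥ fld Ψ y - fld Ψ x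
              = -(fieldLink F κ B x y *ᵥ (fieldLink F κ B y x *ᵥ fld Ψ x - fld Ψ y)) := by
            rw [Matrix.mulVec_sub, Matrix.mulVec_mulVec, fieldLink_mul_rev F κ hB x y, Matrix.one_mulVec]
            abel
          rw [hrev, show -(fieldLink F κ B x y *ᵥ (fieldLink F κ B y x *ᵥ fld Ψ x - fld Ψ y))
              = (-1 : ℝ) • (fieldLink F κ B x y *ᵥ (fieldLink F κ B y x *ᵥ fld Ψ x - fld Ψ y)) by simp,
            siteNorm_smul, abs_neg, abs_one, one_mul]
          show siteNorm (F.U (κ * B x y) *ᵥ _) ≤ β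
          rw [siteNorm_flow]
          exact h1
      show siteNorm ((fieldLink F κ B x y * transport (fieldLink F κ B) y l) *ᵥ fld Ψ (pathEnd y l) - fld Ψ x)
        ≤ ((y :: l).length : ℝ) * β
      rw [List.length_cons, Nat.cast_succ, ← Matrix.mulVec_mulVec,
        show fieldLink F κ B x y *ᵥ (transport (fieldLink F κ B) y l *ᵥ fld Ψ (pathEnd y l)) - fld Ψ x
          = fieldLink F κ B x y *ᵥ (transport (fieldLink F κ B) y l *ᵥ fld Ψ (pathEnd y l) - fld Ψ y)
            + (fieldLink F κ B x y *ᵥ fld Ψ y - fld Ψ x) by rw [Matrix.mulVec_sub]; abel]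
      refine (siteNorm_add_le _ _).trans ?_
      have e1' : siteNorm (fieldLink F κ B x y *ᵥ (transport (fieldLink F κ B) y l *ᵥ fld Ψ (pathEnd y l) - fld Ψ y))
          = siteNorm (transport (fieldLink F κ B) y l *ᵥ fld Ψ (pathEnd y l) - fld Ψ y) :=
        siteNorm_flow F _ _
      rw [e1']
      linarith

omit [DecidableEq X] in
/-- `‖hΦ‖_∞ ≤ ‖Φ‖_∞` for `|h| ≤ 1`. [cite: Balaban1983RegularityDecay, (2.20) p.579, dictionary] -/
theorem supN_mulH_le [DecidableEq X] (h : X → ℝ) (hh : ∀ z, |h z| ≤ 1) (Φ : X × ι → ℝ) :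
    supN (mulH (ι := ι) h *ᵥ Φ) ≤ supN Φ := by
  refine supN_le (supN_nonneg Φ) fun z => ?_
  rw [fld_mulH_mulVec, siteNorm_smul]
  calc |h z| * siteNorm (fld Φ z) ≤ 1 * siteNorm (fld Φ z) :=
        mul_le_mul_of_nonneg_right (hh z) (siteNorm_nonneg _)
    _ ≤ supN Φ := by rw [one_mul]; exact le_supN Φ z

end Tools

/-! ## 2. Lattice sizes: the sup distance of two fine sites -/

omit [Fintype ι] [DecidableEq ι] in
/-- `Σ_ν |x′_ν − x_ν| ≤ (d+1)·|x′ − x|_∞` (the sup distance `|x − x′|` of (1.9)). [cite: Balaban1983RegularityDecay, (1.9) p.573, dictionary] -/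
theorem sum_abs_sub_le_supNorm (x x' : Fin (d + 1) → ℤ) :
    ∑ ν, |((x' ν : ℤ) : ℝ) - x ν| ≤ ((d : ℝ) + 1) * supNorm (x' - x) := by
  calc ∑ ν, |((x' ν : ℤ) : ℝ) - x ν| ≤ ∑ _ν : Fin (d + 1), supNorm (x' - x) := Finset.sum_le_sum fun ν _ => by
        have h := abs_le_supNorm (x' - x) ν
        rw [Pi.sub_apply, Int.cast_abs, Int.cast_sub] at h
        exact h
    _ = ((d : ℝ) + 1) * supNorm (x' - x) := by simp [Finset.sum_const, Finset.card_univ, Fintype.card_fin]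

omit [Fintype ι] [DecidableEq ι] in
/-- two distinct fine sites are at sup distance `≥ 1` (one lattice spacing; (1.9) is stated for `x ≠ x′`). [cite: Balaban1983RegularityDecay, (1.9) p.573, dictionary] -/
theorem one_le_supNorm_of_ne {x x' : Fin (d + 1) → ℤ} (h : x' ≠ x) : 1 ≤ supNorm (x' - x) := by
  obtain ⟨ν, hν⟩ : ∃ ν, x' ν ≠ x ν := by
    by_contra hc
    push Not at hc
    exact h (funext hc)
  have h1 : (1 : ℤ) ≤ |(x' - x) ν| := Int.one_le_abs (sub_ne_zero.2 hν)
  have h2 : ((1 : ℤ) : ℝ) ≤ ((|(x' - x) ν| : ℤ) : ℝ) := by exact_mod_cast h1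
  rw [Int.cast_one] at h2
  exact h2.trans (abs_le_supNorm (x' - x) ν)

/-- the Hölder weight against the scale: `(n/r)^α·(r/n) ≤ K` for `1 ≤ r ≤ nK`, `0 ≤ α ≤ 1`.
[cite: Balaban1983RegularityDecay, (2.14) p.577 «|x−x′|^{−α}», dictionary] -/
theorem holderWt_mul_le {nr r K α : ℝ} (hn : 0 < nr) (hr : 0 < r) (hrK : r ≤ nr * K) (hK : 1 ≤ K)
    (hα0 : 0 ≤ α) (hα1 : α ≤ 1) : (nr / r) ^ α * (r / nr) ≤ K := by
  by_cases h : r ≤ nr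
  · -- `r ≤ n`: `(n/r)^α ≤ (n/r)^1`, product `≤ 1 ≤ K`
    have h1 : 1 ≤ nr / r := by rw [le_div_iff₀ hr, one_mul]; exact h
    have h2 : (nr / r) ^ α ≤ (nr / r) ^ (1 : ℝ) := Real.rpow_le_rpow_of_exponent_le h1 hα1
    rw [Real.rpow_one] at h2
    calc (nr / r) ^ α * (r / nr) ≤ (nr / r) * (r / nr) :=
          mul_le_mul_of_nonneg_right h2 (div_nonneg hr.le hn.le)
      _ = 1 := by field_simp
      _ ≤ K := hK
  · -- `r > n`: `(n/r)^α ≤ 1`, product `≤ r/n ≤ K`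
    have h1 : nr / r ≤ 1 := by rw [div_le_one hr]; linarith
    have h2 : (nr / r) ^ α ≤ 1 := Real.rpow_le_one (div_nonneg hn.le hr.le) h1 hα0
    calc (nr / r) ^ α * (r / nr) ≤ 1 * (r / nr) := mul_le_mul_of_nonneg_right h2 (div_nonneg hr.le hn.le)
      _ ≤ K := by rw [one_mul, div_le_iff₀ hn]; linarith


end

end Literature.MathematicalPhysics.QuantumFieldTheory.Balaban1983to89.B4HolderChainTools
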